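import Summits.NavierStokesRegularity.NavierStokesRegularity.Theorems.TypeICertificateLadderTargetTypeIZoomCompactness
import Literature.Analysis.FluidPDE.NSCriticalClosureBesovKatoClass
import Literature.Analysis.FluidPDE.KatoFarFieldBound
import Literature.Analysis.FluidPDE.KNSSTypeIRateLiouvilleMild
import Literature.Analysis.FluidPDE.SereginSverakBlowupSelection
import HarnessLib

/-!
# Route HubbleDynamo — support item `DynamoKillsTypeI` (stmt-NavierStokesRegularity-1936):
  helper 1, two tools for the KNSS zoom in the POINTWISE Type-I class

Helper file (theorems only) towards the zoom glue `DynamoKillsTypeI` of route HubbleDynamo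
(the zoom itself is `hubbleDynamo_zoom_unit`, helper 2, `HubbleDynamoDynamoKillsTypeIZoom.lean`).

* `hubbleDynamo_farField_pointwise` — the far field of a Clay-class solution (`ν = 1`) stays
  bounded up to the blow-up time: `‖u(t, x)‖ ≤ K` for `t ∈ (T₁, T)`, `‖x‖ > R` (the far-field
  bound of Kato solutions `IsKatoSolutionOn.farField_bound_holds`, Lemarié-Rieusset 2016
  Thm. 15.1 (C), for the Kato solution `isKatoSolutionOn_of_classical`, upgraded from an essential
  to a pointwise bound by joint continuity, `forall_le_of_ae_le_of_continuousOn`). It keeps the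
  Leray points of the zoom in a fixed ball.
* `hubbleDynamo_zoom_limit` — the limit step: given zoomed classical fields `w k` (`ν = 1`) on
  `(A k, B k)`, `A k → −∞`, `0 < B k`, Oseen-mild, with the rate bound `√(−τ)‖w k τ y‖ ≤ C` AND a
  uniform bound `‖w k τ y‖ ≤ K` on `(A k, 0)`, normalised by `‖w k (−σ₀) (y_k)‖ = 1` at points
  with `‖y_k‖ ≤ C'` eventually, and with the eventual decay `‖w k τ y‖ ≤ C'/(‖y‖ + √(−τ))`, the
  subsequential limit `W` of the tree's `typeIZoom_compactness` (KNSS 2009, Lemma 6.1) is a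
  bounded ancient mild solution in duality form (`isBoundedAncientMildSolution_of_oseen`) with
  continuous slices and `HasTypeIDecay C' W`, and `W(−σ₀)` is not a.e. zero (uniform convergence
  on the compact ball `‖y‖ ≤ C'`).

Lands `--supports stmt-NavierStokesRegularity-1936`.
-/

noncomputable section

namespace Summit.NavierStokesRegularity.NavierStokesRegularity.Theorems

open MeasureTheory Set Filter Topology Function Metric
open scoped RealInnerProductSpace NNReal ENNReal
open Literature.Analysis Literature.Analysis.FluidPDE

/-! ### The far field of a Clay-class solution, pointwise -/

/-- **The far field stays bounded up to the blow-up time, pointwise.** For `T > 0` and a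
classical solution `(u, p)` (`ν = 1`) on `ℝ³ × [0, T)`, Leray–Hopf from its rapidly decaying
datum, there are `T₁ < T` and `R, K` with `‖u(t, x)‖ ≤ K` for all `t ∈ (T₁, T)` and `‖x‖ > R`:
`u` is a Kato `C_t L³` solution (`isKatoSolutionOn_of_classical`), essentially bounded on
`(T − δ, T) × {‖x‖ > R}` (`IsKatoSolutionOn.farField_bound_holds`), and jointly continuous below
`T`, so the essential bound holds at every point of the open set `(max(T − δ, 0), T) × {‖x‖ > R}`
(`forall_le_of_ae_le_of_continuousOn`). [cite: LemarieRieusset2016, Thm. 15.1 (C), proof p. 566] -/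
theorem hubbleDynamo_farField_pointwise {T : ℝ} (hT : 0 < T)
    {u : ℝ → EuclideanSpace ℝ (Fin 3) → EuclideanSpace ℝ (Fin 3)}
    {p : ℝ → EuclideanSpace ℝ (Fin 3) → ℝ}
    (hcl : IsClassicalNSSolutionOn (Ico 0 T) 1 0 u p) (hLH : IsLerayHopfOn T 1 0 (u 0) u)
    (hdec : HasRapidSpatialDecay (u 0)) :
    ∃ T₁ < T, ∃ R K : ℝ, ∀ t ∈ Ioo T₁ T, ∀ x, R < ‖x‖ → ‖u t x‖ ≤ K := by
  have hkato := isKatoSolutionOn_of_classical one_pos hT hcl hLH hdec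
  obtain ⟨δ, hδ, R, hfar⟩ := IsKatoSolutionOn.farField_bound_holds one_pos hT hkato
  set μU : Measure (ℝ × EuclideanSpace ℝ (Fin 3)) := (volume : Measure (ℝ × EuclideanSpace ℝ (Fin 3))).restrict
    (Ioo (T - δ) T ×ˢ (closedBall (0 : EuclideanSpace ℝ (Fin 3)) R)ᶜ) with hμU
  set N : ℝ≥0∞ := eLpNorm (uncurry u) ∞ μU with hN
  have hNtop : N ≠ ∞ := hfar.ne
  set U' : Set (ℝ × EuclideanSpace ℝ (Fin 3)) :=
    Ioo (max (T - δ) 0) T ×ˢ (closedBall (0 : EuclideanSpace ℝ (Fin 3)) R)ᶜ with hU'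
  have hU'open : IsOpen U' := isOpen_Ioo.prod isClosed_closedBall.isOpen_compl
  have hsub : U' ⊆ Ioo (T - δ) T ×ˢ (closedBall (0 : EuclideanSpace ℝ (Fin 3)) R)ᶜ :=
    prod_mono (Ioo_subset_Ioo_left (le_max_left _ _)) Subset.rfl
  have hcont : ContinuousOn (uncurry u) (Ico 0 T ×ˢ univ) := hcl.smooth_velocity.continuousOn
  have hcontU : ContinuousOn (fun z => ‖uncurry u z‖) U' :=
    (hcont.mono (prod_mono (fun t ht => ⟨(le_max_right _ _).trans ht.1.le, ht.2⟩)
      (subset_univ _))).norm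
  have hae : ∀ᵐ z ∂μU, ‖uncurry u z‖ ≤ N.toReal := by
    have h1 := ae_le_eLpNormEssSup (μ := μU) (f := uncurry u)
    filter_upwards [h1] with z hz
    have h2 : ‖uncurry u z‖ₑ ≤ N := by rw [hN, eLpNorm_exponent_top]; exact hz
    rw [← ofReal_norm] at h2
    exact (ENNReal.ofReal_le_iff_le_toReal hNtop).1 h2
  have hae' : ∀ᵐ z ∂((volume : Measure (ℝ × EuclideanSpace ℝ (Fin 3))).restrict U'),
      ‖uncurry u z‖ ≤ N.toReal :=
    ae_restrict_of_ae_restrict_of_subset hsub hae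
  have hall := SereginSverak2009.forall_le_of_ae_le_of_continuousOn hU'open hcontU
    continuousOn_const hae'
  refine ⟨max (T - δ) 0, max_lt (by linarith) hT, R, N.toReal, fun t ht x hx => ?_⟩
  exact hall (t, x) ⟨ht, fun h => (not_le.2 hx) (mem_closedBall_zero_iff.1 h)⟩

/-! ### The limit of a normalised zoomed sequence with pointwise decay -/

/-- **The limit step of the zoom in the pointwise class** (KNSS 2009, Lemma 6.1 and proof of
Thm. 6.2, arXiv:0709.3599 pp. 11–13, through the tree's `typeIZoom_compactness`). Zoomed
classical fields `w k` (`ν = 1`) on `ℝ³ × (A k, B k)` with `A k → −∞`, `0 < B k`, Oseen-mild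
between all times, with `√(−τ)‖w k τ y‖ ≤ C` and `‖w k τ y‖ ≤ K` on `(A k, 0)`, normalised by
`‖w k (−σ₀) (y_k)‖ = 1` (`σ₀ > 0`) at points `y_k` with `‖y_k‖ ≤ C'` eventually, and with
`‖w k τ y‖ ≤ C'/(‖y‖ + √(−τ))` eventually in `k` for each `τ < 0`, `y`: a subsequential limit
`W` is a bounded ancient mild solution (`ν = 1`, duality form) with a.e.-strongly measurable
slices and `HasTypeIDecay C' W`, and some slice `W t`, `t < 0`, is not a.e. zero (namely
`t = −σ₀`: `W(−σ₀)` is continuous, and `w (φ k) (−σ₀) → W(−σ₀)` uniformly on `‖y‖ ≤ C'`).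
[cite: KochNadirashviliSereginSverak2009, Lemma 6.1 (arXiv p. 11) and proof of Thm 6.2 (p. 13)] -/
theorem hubbleDynamo_zoom_limit {C K σ₀ C' : ℝ} (hC : 0 < C) (hσ₀ : 0 < σ₀) (A B : ℕ → ℝ)
    (w : ℕ → ℝ → EuclideanSpace ℝ (Fin 3) → EuclideanSpace ℝ (Fin 3))
    (q : ℕ → ℝ → EuclideanSpace ℝ (Fin 3) → ℝ) (ys : ℕ → EuclideanSpace ℝ (Fin 3))
    (hAlim : Tendsto A atTop atBot) (hBpos : ∀ k, 0 < B k)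
    (hwcl : ∀ k, IsClassicalNSSolutionOn (Ioo (A k) (B k)) 1 0 (w k) (q k))
    (hwmild : ∀ k, ∀ s t : ℝ, A k < s → s < t → t < B k → ∀ y,
      w k t y = UnboundedOperators.heatExtension (w k s) (t - s) y -
        oseenDuhamel 1 s (w k) (w k) t y)
    (hwI : ∀ k, ∀ τ ∈ Ioo (A k) 0, ∀ y, Real.sqrt (-τ) * ‖w k τ y‖ ≤ C)
    (hwB : ∀ k, ∀ τ ∈ Ioo (A k) 0, ∀ y, ‖w k τ y‖ ≤ K)
    (hnorm1 : ∀ k, ‖w k (-σ₀) (ys k)‖ = 1) (hys : ∀ᶠ k in atTop, ‖ys k‖ ≤ C')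
    (hwD : ∀ τ < 0, ∀ y, ∀ᶠ k in atTop, ‖w k τ y‖ ≤ C' / (‖y‖ + Real.sqrt (-τ))) :
    ∃ W : ℝ → EuclideanSpace ℝ (Fin 3) → EuclideanSpace ℝ (Fin 3),
      IsBoundedAncientMildSolution 1 W ∧ (∀ t < 0, AEStronglyMeasurable (W t) volume) ∧
      (∃ C' : ℝ, HasTypeIDecay C' W) ∧ ∃ t < 0, ¬ (W t =ᵐ[volume] 0) := by
  have hneg : -σ₀ < 0 := neg_neg_of_pos hσ₀
  obtain ⟨φ, W, hφ, hWc, hWdiv, -, hWmild, hWconv⟩ :=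
    typeIZoom_compactness C A B w q hC hAlim hBpos hwcl hwmild hwI
  have hφt : Tendsto φ atTop atTop := hφ.tendsto_atTop
  have hpt : ∀ t < 0, ∀ x, Tendsto (fun k => w (φ k) t x) atTop (𝓝 (W t x)) := fun t ht x =>
    (tendstoLocallyUniformlyOn_univ.2 (hWconv t ht)).tendsto_at (mem_univ _)
  have hdom : ∀ t : ℝ, ∀ᶠ j in atTop, A (φ j) < t := fun t =>
    (hAlim.comp hφt).eventually (eventually_lt_atBot t)
  have hWslice : ∀ t < 0, Continuous (W t) := fun t ht =>
    hWc.comp_continuous (f := fun x : EuclideanSpace ℝ (Fin 3) => (t, x)) (by fun_prop)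
      fun x => ⟨ht, mem_univ _⟩
  -- boundedness of the limit
  have hWB : ∀ t < 0, ∀ x, ‖W t x‖ ≤ K := fun t ht x => by
    refine le_of_tendsto (hpt t ht x).norm ?_
    filter_upwards [hdom t] with j hj
    exact hwB (φ j) t ⟨hj, ht⟩ x
  -- the limit is a bounded ancient mild solution (duality form)
  have hWsol : IsBoundedAncientMildSolution 1 W :=
    isBoundedAncientMildSolution_of_oseen one_pos hWc ⟨_, hWB⟩ hWdiv
      (fun s t hst ht x => by rw [one_mul]; exact hWmild s t hst ht x)
  -- the pointwise Type-I decay of the limit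
  have hWD : HasTypeIDecay C' W := fun t ht x =>
    le_of_tendsto (hpt t ht x).norm (hφt.eventually (hwD t ht x))
  refine ⟨W, hWsol, fun t ht => (hWslice t ht).aestronglyMeasurable, ⟨C', hWD⟩, -σ₀, hneg,
    fun h0 => ?_⟩
  -- the slice `W(−σ₀)` is not a.e. zero
  have hW0 : W (-σ₀) = fun _ => 0 :=
    (Continuous.ae_eq_iff_eq volume (hWslice _ hneg) continuous_const).1 h0
  have hunif : TendstoUniformlyOn (fun k => w (φ k) (-σ₀)) (W (-σ₀)) atTop
      (closedBall (0 : EuclideanSpace ℝ (Fin 3)) C') :=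
    (tendstoLocallyUniformly_iff_forall_isCompact.1 (hWconv _ hneg)) _ (isCompact_closedBall _ _)
  have hev := Metric.tendstoUniformlyOn_iff.1 hunif 1 one_pos
  have hysφ : ∀ᶠ k in atTop, ‖ys (φ k)‖ ≤ C' := hφt.eventually hys
  obtain ⟨k, hk1, hk2⟩ := (hev.and hysφ).exists
  have h := hk1 (ys (φ k)) (mem_closedBall_zero_iff.2 hk2)
  have h0y : W (-σ₀) (ys (φ k)) = 0 := by rw [hW0]
  rw [h0y, dist_comm, dist_zero_right, hnorm1] at h
  exact lt_irrefl _ h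

end Summit.NavierStokesRegularity.NavierStokesRegularity.Theorems

end
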